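import Summits.CriticalPhenomena.Ising3D.Control2DRadialEquation
import Mathlib.Analysis.SpecialFunctions.Pow.Continuity
import Mathlib.Analysis.SpecialFunctions.Sqrt
import Mathlib.Tactic.Linarith
import Mathlib.Tactic.Positivity
import Mathlib.Tactic.FieldSimp
import Mathlib.Tactic.Ring
import Mathlib.Tactic.LinearCombination
import HarnessLib

/-!
# The `ρ`-expansion of the chiral blocks: `k_{2h}(4ρ/(1+ρ)²) = (4ρ)^h ₂F₁(½,h;h+½;ρ²)` — the quadratic transformation (Gauss; Hogervorst–Rychkov's `ρ`-series) by the differential equation and Abel's identity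
(cell `pub-ising3x`, seat controls-1 gen 48; PAPER §6.2 / Appendix E — CONTROL-ONLY; part 2, companion of
`Control2DRadialEquation` and `Control2DRhoCoordinate`)

HONEST FRAMING: lottery ticket; floor = tightest certified 3D Ising CFT bounds; no exact-solution
claim without a proof. CONTROL-ONLY (`d = 2`, global `sl(2) × sl(2)` blocks, `Δ_σ = s` an INPUT, axiom set `A2D′`);
nothing here is about `d = 3`, no certificate, functional or number of the record is touched, and no new hypothesis,
definition or named fact enters. PURE BLOCK ANALYSIS (no datum).

WHAT THIS FILE ADDS. Pappadopulo–Rychkov–Espin–Rattazzi 2012 §5 obtain, from the Hilbert space of a CFT, that the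
expansion of the correlator in the radial variable `ρ` (`z = 4ρ/(1+ρ)²`) has non-negative coefficients; for the typed
two-dimensional class, whose blocks are the closed forms `k_{2h}(z) = z^h ₂F₁(h,h;2h;z)`, that positivity is the
`ρ`-SERIES of the blocks, `k_{2h}(4ρ/(1+ρ)²) = (4ρ)^h ₂F₁(½,h;h+½;ρ²)` (Hogervorst–Rychkov 2013), i.e. the case `a = b = h` of
GAUSS'S QUADRATIC TRANSFORMATION `₂F₁(a,b;2b;4x/(1+x)²) = (1+x)^{2a}₂F₁(a,a-b+½;b+½;x²)` — listed NOT claimed in E.1n, E.1u,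
E.1w, E.1x, E.1y of the paper's Appendix E (only its leading-term inequality `(4ρ)^h ≤ k_{2h}`, `Control2DRhoCoordinate`, and
an upper bound of the same exponential order, `Control2DRhoUpperEnvelope`, were proved). It is PROVED here:

* **`ordinaryHypergeometric_quadratic`** — `₂F₁(h,h;2h;4ρ/(1+ρ)²) = (1+ρ)^{2h}·₂F₁(½,h;h+½;ρ²)` for `h > 0`, `0 < ρ < 1`.
  PROOF (Rainville's differential-equation route with the Frobenius step replaced by Abel's identity — the method of
  the tree's `LegendrePQuadraticTransformation`, here for other parameters): by `Control2DRadialEquation` both sides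
  solve `ρ(1-ρ²)y'' + (2h(1-ρ)² - 2ρ²)y' - (4h²(1-ρ)/(1+ρ))y = 0` on `(0,1)` and `Z = ρ^{2h}(1-ρ)(1+ρ)^{1-4h}·(Y·Y₂' - Y'·Y₂)`
  is constant there; `Z → 0` as `ρ → 0⁺` (`ρ^{2h} → 0` while `Y, Y₂ → 1` and `Y', Y₂' → 2h` — every factor is continuous at
  `0`), so the Wronskian vanishes, `Y/Y₂` has zero derivative on `(0,1)` (`Y₂ > 0`: positive coefficients,
  `ordinaryHypergeometric_half_pos`) and tends to `1` at `0⁺`;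
* **`chiralBlock_eq_rho`** — `k_{2h}(4ρ/(1+ρ)²) = (4ρ)^h·₂F₁(½,h;h+½;ρ²)` for every `h ≥ 0`, `ρ ∈ (0,1)` (`h = 0`: both sides
  are `1`, `chiralBlock_zero` and `(0)_n = 0`); **`chiralBlock_eq_rho_rhoZ`** — the same at every `z ∈ (0,1)` with PRER's
  `ρ(z) = (1-√(1-z))/(1+√(1-z))` written out (`four_mul_rhoZ_div_sq`).

The typed-class consequences (non-negativity of all `ρ`-coefficients, the h-free two-sided envelope
`(4ρ)^h ≤ k_{2h} ≤ (4ρ)^h(1-ρ²)^{-1/2}`, the rate with prefactor `E^{4s}`) are in `Control2DRhoEnvelopeSharp`.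

NOT claimed: the general `(a, b)` Gauss transformation (only `a = b = h > 0`, real `0 < ρ < 1`); anything at complex
argument / on the cut plane (where Pappadopulo–Rychkov–Espin–Rattazzi's statement lives in full); Korevaar's logarithmic
Tauberian remainder; lower bounds on single `p_i`; anything at `s = 0`; Virasoro; anything three-dimensional; any bound on
`Δ_ε`, `c` or `λ²`; nothing of the record touched, no new hypothesis, definition or named fact. CONTEXT, not inputs:
PRER 2012 §5 / Hogervorst–Rychkov 2013 / Andrews–Askey–Roy §3.1 / arXiv:1411.5262 §1–§2 («the one originally obtained by
Gauss … in the standard text of Rainville the transformation was derived using the differential equation satisfied by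
₂F₁»); INPUTS = the two tree theorems `hasDerivAt_ordinaryHypergeometric` (`ZhouLegendreGreenValuesProofs`) and
`ordinaryHypergeometric_ode` (`EisensteinE4Hypergeometric`), by name, through `Control2DRadialEquation`.

References: G. E. Andrews, R. Askey, R. Roy, *Special Functions* (1999), §3.1 [cite: AndrewsAskeyRoy1999, §3.1];
M. Hogervorst, S. Rychkov, Phys. Rev. D 87 (2013) 106004, §2 [cite: HogervorstRychkov2013, §2]; D. Pappadopulo, S. Rychkov,
J. Espin, R. Rattazzi, Phys. Rev. D 86 (2012) 105043, §5.2 [cite: PappadopuloRychkovEspinRattazzi2012PRD, §5.2];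
F. A. Dolan, H. Osborn, Nucl. Phys. B 678 (2004) 491, §3 [cite: DolanOsborn2004, §3]. Tree: `chiralBlock`, `chiralBlock_zero`
(`Control2DBootstrap`); `four_mul_div_sq_mem_Ioo`, `rhoZ_mem_Ioo`, `four_mul_rhoZ_div_sq` (`Control2DRhoCoordinate`);
`radialY_deriv_data`, `radialY₂_deriv_data`, `hasDerivAt_radial_wronskian` (`Control2DRadialEquation`);
`hasSum_ordinaryHypergeometric`, `hasDerivAt_ordinaryHypergeometric` (Literature `ZhouLegendreGreenValuesProofs`). Mathlib:
`ordinaryHypergeometric_zero`, `ordinaryHypergeometricSeries_eq_zero_of_neg_nat`, `IsOpen.is_const_of_deriv_eq_zero`,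
`IsOpen.exists_is_const_of_deriv_eq_zero`, `tendsto_nhds_unique`, `Real.continuousAt_rpow_const`, `ContinuousAt.rpow_const`,
`Real.div_rpow`, `Real.rpow_mul`.
-/

namespace Summit.CriticalPhenomena.Ising3D.Control2D

open Set Filter Topology
open Literature.NumberTheory.Automorphic.LegendreP (hasDerivAt_ordinaryHypergeometric hasSum_ordinaryHypergeometric)

/-! ### Positivity of `₂F₁(½,h;h+½;x)` on `[0,1)` -/

/-- `₂F₁(½,h;h+½;x) > 0` for `h > 0`, `0 ≤ x < 1`: every coefficient `(½)_n (h)_n/(n!(h+½)_n)` is positive and the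
`n = 0` term is `1`. [folklore] -/
theorem ordinaryHypergeometric_half_pos {h x : ℝ} (hh : 0 < h) (hx0 : 0 ≤ x) (hx1 : x < 1) :
    0 < ordinaryHypergeometric (1 / 2) h (h + 1 / 2) x := by
  have hx : |x| < 1 := by rw [abs_of_nonneg hx0]; exact hx1
  have hs := hasSum_ordinaryHypergeometric (1 / 2) h (h + 1 / 2) hx
  have hcoef : ∀ n, 0 < ordinaryHypergeometricCoefficient (1 / 2 : ℝ) h (h + 1 / 2) n := by
    intro n
    rw [ordinaryHypergeometricCoefficient]
    have ha : 0 < (ascPochhammer ℝ n).eval (1 / 2 : ℝ) := ascPochhammer_pos n (1 / 2) (by norm_num)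
    have hb : 0 < (ascPochhammer ℝ n).eval h := ascPochhammer_pos n h hh
    have hc : 0 < (ascPochhammer ℝ n).eval (h + 1 / 2) := ascPochhammer_pos n (h + 1 / 2) (by positivity)
    positivity
  refine lt_of_lt_of_le (hcoef 0) ?_
  have h1 := sum_le_hasSum {0} (fun m _ => mul_nonneg (hcoef m).le (pow_nonneg hx0 m)) hs
  simpa using h1

/-! ### The quadratic transformation -/

/-- **Gauss's quadratic transformation at `a = b = h`** (`h > 0`, `0 < ρ < 1`):
`₂F₁(h,h;2h;4ρ/(1+ρ)²) = (1+ρ)^{2h}·₂F₁(½,h;h+½;ρ²)` — the case `a = b` of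
`₂F₁(a,b;2b;4x/(1+x)²) = (1+x)^{2a}₂F₁(a,a-b+½;b+½;x²)`. PROOF by the differential equation (Rainville's route, with
the Frobenius step replaced by Abel's identity): both sides solve the radial equation (`radialY_ode`, `radialY₂_ode`),
so `Z = ρ^{2h}(1-ρ)(1+ρ)^{1-4h}·W` is constant on `(0,1)` (`hasDerivAt_radial_wronskian`); `Z → 0` as `ρ → 0⁺`
(`ρ^{2h} → 0`, the other factors have finite limits), so the Wronskian `W` vanishes, the ratio of the two sides is
constant on `(0,1)`, and it tends to `1` at `0⁺`. [cite: AndrewsAskeyRoy1999, §3.1] -/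
theorem ordinaryHypergeometric_quadratic {h : ℝ} (hh : 0 < h) {ρ : ℝ} (hρ : ρ ∈ Ioo (0 : ℝ) 1) :
    ordinaryHypergeometric h h (2 * h) (4 * ρ / (1 + ρ) ^ 2) =
      (1 + ρ) ^ (2 * h) * ordinaryHypergeometric (1 / 2) h (h + 1 / 2) (ρ ^ 2) := by
  set Yf : ℝ → ℝ := fun r => ordinaryHypergeometric h h (2 * h) (4 * r / (1 + r) ^ 2) with hYf
  set Vf : ℝ → ℝ := fun r => (1 + r) ^ (2 * h) * ordinaryHypergeometric (1 / 2) h (h + 1 / 2) (r ^ 2)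
    with hVf
  -- explicit first derivatives (continuous at `0`)
  set Y₁ : ℝ → ℝ := fun r => h * h / (2 * h) *
    ordinaryHypergeometric (h + 1) (h + 1) (2 * h + 1) (4 * r / (1 + r) ^ 2) * (4 * (1 - r) / (1 + r) ^ 3) with hY₁
  set V₁ : ℝ → ℝ := fun r => 2 * h * (1 + r) ^ (2 * h - 1) * ordinaryHypergeometric (1 / 2) h (h + 1 / 2) (r ^ 2) +
    (1 + r) ^ (2 * h) * (1 / 2 * h / (h + 1 / 2) *
      ordinaryHypergeometric (1 / 2 + 1) (h + 1) (h + 1 / 2 + 1) (r ^ 2) * (2 * r)) with hV₁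
  have hdY : ∀ r ∈ Ioo (0 : ℝ) 1, deriv Yf r = Y₁ r := fun r hr => (radialY_deriv_data h hr).1.deriv
  have hdV : ∀ r ∈ Ioo (0 : ℝ) 1, deriv Vf r = V₁ r := fun r hr => (radialY₂_deriv_data (h := h) hr).1.deriv
  -- `Z` is constant on `(0,1)`
  set Z : ℝ → ℝ := fun r => r ^ (2 * h) * (1 - r) * (1 + r) ^ (1 - 4 * h) *
    (Yf r * deriv Vf r - deriv Yf r * Vf r) with hZ
  have hZc : ∀ r ∈ Ioo (0 : ℝ) 1, Z r = Z (1 / 2) := fun r hr =>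
    IsOpen.is_const_of_deriv_eq_zero isOpen_Ioo (convex_Ioo (0 : ℝ) 1).isPreconnected
      (fun x hx => (hasDerivAt_radial_wronskian hh hx).differentiableAt.differentiableWithinAt)
      (fun x hx => (hasDerivAt_radial_wronskian hh hx).deriv) hr ⟨by norm_num, by norm_num⟩
  -- continuity at `0` of the pieces
  have hz0 : ContinuousAt (fun r : ℝ => 4 * r / (1 + r) ^ 2) 0 :=
    ((continuousAt_const.mul continuousAt_id).div ((continuousAt_const.add continuousAt_id).pow 2)
      (by norm_num))
  have hF0 : ∀ a b c : ℝ, ContinuousAt (fun r : ℝ => ordinaryHypergeometric a b c (4 * r / (1 + r) ^ 2)) 0 := by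
    intro a b c
    have hc : ContinuousAt (ordinaryHypergeometric a b c) (4 * (0 : ℝ) / (1 + 0) ^ 2) :=
      (hasDerivAt_ordinaryHypergeometric (a := a) (b := b) (c := c) (by norm_num)).continuousAt
    exact ContinuousAt.comp (g := ordinaryHypergeometric a b c) hc hz0
  have hG0 : ∀ a b c : ℝ, ContinuousAt (fun r : ℝ => ordinaryHypergeometric a b c (r ^ 2)) 0 := by
    intro a b c
    have hc : ContinuousAt (ordinaryHypergeometric a b c) ((0 : ℝ) ^ 2) :=
      (hasDerivAt_ordinaryHypergeometric (a := a) (b := b) (c := c) (by norm_num)).continuousAt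
    exact ContinuousAt.comp (g := ordinaryHypergeometric a b c) hc (continuousAt_id.pow 2)
  have hP0 : ∀ p : ℝ, ContinuousAt (fun r : ℝ => (1 + r) ^ p) 0 := fun p =>
    (continuousAt_const.add continuousAt_id).rpow_const (Or.inl (by norm_num))
  have hYc : ContinuousAt Yf 0 := hF0 h h (2 * h)
  have hVc : ContinuousAt Vf 0 := (hP0 (2 * h)).mul (hG0 (1 / 2) h (h + 1 / 2))
  have hY₁c : ContinuousAt Y₁ 0 :=
    ((continuousAt_const.mul (hF0 (h + 1) (h + 1) (2 * h + 1))).mul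
      ((continuousAt_const.mul (continuousAt_const.sub continuousAt_id)).div
        ((continuousAt_const.add continuousAt_id).pow 3) (by norm_num)))
  have hV₁c : ContinuousAt V₁ 0 :=
    ((continuousAt_const.mul (hP0 (2 * h - 1))).mul (hG0 (1 / 2) h (h + 1 / 2))).add
      ((hP0 (2 * h)).mul ((continuousAt_const.mul (hG0 (1 / 2 + 1) (h + 1) (h + 1 / 2 + 1))).mul
        (continuousAt_const.mul continuousAt_id)))
  -- `Z → 0` at `0⁺`
  have hIoo : Ioo (0 : ℝ) 1 ∈ 𝓝[>] (0 : ℝ) := Ioo_mem_nhdsGT (by norm_num)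
  have hM : Tendsto (fun r => (1 - r) * (1 + r) ^ (1 - 4 * h) * (Yf r * deriv Vf r - deriv Yf r * Vf r))
      (𝓝[>] 0) (𝓝 ((1 - 0) * (1 + 0) ^ (1 - 4 * h) * (Yf 0 * V₁ 0 - Y₁ 0 * Vf 0))) := by
    have hc : ContinuousAt (fun r => (1 - r) * (1 + r) ^ (1 - 4 * h) * (Yf r * V₁ r - Y₁ r * Vf r)) 0 :=
      ((continuousAt_const.sub continuousAt_id).mul (hP0 (1 - 4 * h))).mul
        ((hYc.mul hV₁c).sub (hY₁c.mul hVc))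
    refine (hc.tendsto.mono_left nhdsWithin_le_nhds).congr' ?_
    filter_upwards [hIoo] with r hr
    simp only [hdY r hr, hdV r hr]
  have hρpow : Tendsto (fun r : ℝ => r ^ (2 * h)) (𝓝[>] 0) (𝓝 0) := by
    have hc := (Real.continuousAt_rpow_const 0 (2 * h) (Or.inr (by positivity))).tendsto
    rw [Real.zero_rpow (by positivity)] at hc
    exact hc.mono_left nhdsWithin_le_nhds
  have hZ0 : Tendsto Z (𝓝[>] 0) (𝓝 0) := by
    have h := hρpow.mul hM
    rw [zero_mul] at h
    refine h.congr' (Eventually.of_forall fun r => ?_)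
    simp only [hZ]; ring
  have hZhalf : Z (1 / 2) = 0 := by
    have hlim : Tendsto Z (𝓝[>] 0) (𝓝 (Z (1 / 2))) := by
      refine tendsto_const_nhds.congr' ?_
      filter_upwards [hIoo] with r hr
      exact (hZc r hr).symm
    exact tendsto_nhds_unique hlim hZ0
  -- the Wronskian vanishes on `(0,1)`
  have hW : ∀ r ∈ Ioo (0 : ℝ) 1, Yf r * deriv Vf r - deriv Yf r * Vf r = 0 := by
    intro r hr
    have hz := hZc r hr
    rw [hZhalf] at hz
    have hw : r ^ (2 * h) * (1 - r) * (1 + r) ^ (1 - 4 * h) ≠ 0 := by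
      have h1 : 0 < r ^ (2 * h) := Real.rpow_pos_of_pos hr.1 _
      have h2 : 0 < 1 - r := by linarith [hr.2]
      have h3 : 0 < (1 + r) ^ (1 - 4 * h) := Real.rpow_pos_of_pos (by linarith [hr.1]) _
      positivity
    exact (mul_eq_zero.mp hz).resolve_left hw
  -- positivity of `Vf` on `[0,1)`
  have hVpos : ∀ r, 0 ≤ r → r < 1 → 0 < Vf r := fun r hr0 hr1 =>
    mul_pos (Real.rpow_pos_of_pos (by linarith) _)
      (ordinaryHypergeometric_half_pos hh (sq_nonneg r) (by nlinarith))
  -- the ratio is constant on `(0,1)`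
  have hquot : ∀ r ∈ Ioo (0 : ℝ) 1, HasDerivAt (fun x => Yf x / Vf x) 0 r := by
    intro r hr
    obtain ⟨hY, -⟩ := radialY_deriv_data h hr
    obtain ⟨hV, -⟩ := radialY₂_deriv_data (h := h) hr
    have hYd : HasDerivAt Yf (deriv Yf r) r := hY.differentiableAt.hasDerivAt
    have hVd : HasDerivAt Vf (deriv Vf r) r := hV.differentiableAt.hasDerivAt
    refine ((hYd.div hVd (hVpos r hr.1.le hr.2).ne')).congr_deriv ?_
    rw [div_eq_zero_iff]
    left
    linear_combination -(hW r hr)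
  obtain ⟨c, hc⟩ := IsOpen.exists_is_const_of_deriv_eq_zero (f := fun x => Yf x / Vf x)
    isOpen_Ioo (convex_Ioo (0 : ℝ) 1).isPreconnected
    (fun x hx => (hquot x hx).differentiableAt.differentiableWithinAt)
    (fun x hx => (hquot x hx).deriv)
  -- the constant is `1`: limit at `0⁺`
  have hY0 : Yf 0 = 1 := by simp [hYf]
  have hV0 : Vf 0 = 1 := by simp [hVf]
  have hc1 : c = 1 := by
    have hlim : Tendsto (fun x => Yf x / Vf x) (𝓝[>] 0) (𝓝 (Yf 0 / Vf 0)) :=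
      ((hYc.div hVc (by rw [hV0]; norm_num)).tendsto).mono_left nhdsWithin_le_nhds
    rw [hY0, hV0, div_one] at hlim
    have hlim' : Tendsto (fun x => Yf x / Vf x) (𝓝[>] 0) (𝓝 c) := by
      refine tendsto_const_nhds.congr' ?_
      filter_upwards [hIoo] with x hx
      exact (hc x hx).symm
    exact tendsto_nhds_unique hlim' hlim
  have h := hc ρ hρ
  rw [hc1, div_eq_one_iff_eq (hVpos ρ hρ.1.le hρ.2).ne'] at h
  simpa [hYf, hVf] using h


/-! ### The `ρ`-series of the chiral blocks -/

/-- **Hogervorst–Rychkov's `ρ`-series of the chiral block**: `k_{2h}(4ρ/(1+ρ)²) = (4ρ)^h · ₂F₁(½, h; h+½; ρ²)` for every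
`h ≥ 0`, `ρ ∈ (0,1)` (`h = 0`: both sides are `1`; `h > 0`: `ordinaryHypergeometric_quadratic` times
`z^h = (4ρ)^h (1+ρ)^{-2h}`). [cite: HogervorstRychkov2013, §2] -/
theorem chiralBlock_eq_rho {h : ℝ} (hh : 0 ≤ h) {ρ : ℝ} (hρ : ρ ∈ Ioo (0 : ℝ) 1) :
    chiralBlock h (4 * ρ / (1 + ρ) ^ 2) = (4 * ρ) ^ h * ordinaryHypergeometric (1 / 2) h (h + 1 / 2) (ρ ^ 2) := by
  rcases hh.eq_or_lt with heq | hpos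
  · -- `h = 0`: `k_0 = 1` and `₂F₁(½, 0; ½; ·) = 1` (every coefficient beyond the constant carries `(0)_n = 0`)
    subst heq
    have h1 : ∀ n : ℕ, n ≠ 0 →
        (ordinaryHypergeometricSeries ℝ (1 / 2 : ℝ) 0 (0 + 1 / 2) n fun _ => ρ ^ 2) = 0 := by
      intro n hn
      rw [ordinaryHypergeometricSeries_eq_zero_of_neg_nat (𝔸 := ℝ) (a := (1 / 2 : ℝ)) (b := 0) (c := 0 + 1 / 2)
        (k := 0) (Or.inr (Or.inl (by simp))) (Nat.pos_of_ne_zero hn)]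
      rfl
    have hF : ordinaryHypergeometric (1 / 2 : ℝ) 0 (0 + 1 / 2) (ρ ^ 2) = 1 := by
      rw [ordinaryHypergeometric, FormalMultilinearSeries.sum, tsum_eq_single 0 h1,
        ordinaryHypergeometricSeries_apply_eq]
      simp
    rw [chiralBlock_zero, Real.rpow_zero, hF, one_mul]
  · have h0 : 0 < ρ := hρ.1
    have h1 : 0 < 1 + ρ := by linarith
    have hz : ((4 * ρ / (1 + ρ) ^ 2) : ℝ) ^ h = (4 * ρ) ^ h / (1 + ρ) ^ (2 * h) := by
      rw [Real.div_rpow (by positivity) (by positivity), show ((1 + ρ) ^ 2 : ℝ) = (1 + ρ) ^ (2 : ℝ) by norm_cast,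
        ← Real.rpow_mul h1.le]
    rw [chiralBlock, ordinaryHypergeometric_quadratic hpos hρ, hz]
    have hne : (1 + ρ) ^ (2 * h) ≠ 0 := (Real.rpow_pos_of_pos h1 _).ne'
    field_simp

/-- The `ρ`-series at every `z ∈ (0,1)`: with PRER's `ρ(z) = (1-√(1-z))/(1+√(1-z))` (written out, `four_mul_rhoZ_div_sq`),
`k_{2h}(z) = (4ρ(z))^h · ₂F₁(½, h; h+½; ρ(z)²)` for `h ≥ 0`. [cite: HogervorstRychkov2013, §2] -/
theorem chiralBlock_eq_rho_rhoZ {h : ℝ} (hh : 0 ≤ h) {z : ℝ} (hz : z ∈ Ioo (0 : ℝ) 1) :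
    chiralBlock h z =
      (4 * ((1 - Real.sqrt (1 - z)) / (1 + Real.sqrt (1 - z)))) ^ h *
        ordinaryHypergeometric (1 / 2) h (h + 1 / 2) (((1 - Real.sqrt (1 - z)) / (1 + Real.sqrt (1 - z))) ^ 2) := by
  have h := chiralBlock_eq_rho hh (rhoZ_mem_Ioo hz)
  rwa [four_mul_rhoZ_div_sq hz] at h

end Summit.CriticalPhenomena.Ising3D.Control2D
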